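import Summits.AtomisticToContinuum.Crystallization.Theses.ChessboardParticlePlanes
import Literature.MathematicalPhysics.StatisticalMechanics.LocalMatchingCompactness

/-!
# Crux `PeriodicWindows` (stmt-AtomisticToContinuum-3240), line `Sketch` — pigeonhole glue for the lever

Helper for the lead skeleton `PeriodicWindowsSketch` (rev 6, route `ChessboardParticlePlanes`). The lever of the
line (rev-4/5 stub `stub_cleanBallsOfBulkOptimal`: a bulk-optimal, hard-core-GSC, dense, laminar, separated
configuration has CLEAN — locally mirror-symmetric — balls of every size) is reduced to its natural SUM FORM
(rev-6 stub `stub_mirrorBadDensityZero`: the number of mirror-bad particles in an `L`-ball is `≤ θ L³` for all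
large `L`, every centre and every `θ > 0`, which is what a chessboard estimate with coercive deficits delivers) by
the pigeonhole lemma `cleanBalls_of_badDensityZero` proved here: a cubic grid of `M³` pairwise `4ρ`-separated
centres in `B̄(0, 2L)`, `L = 4ρM`; if every `ρ`-ball about a grid centre held a mirror-bad particle these particles
would be distinct, giving `M³ ≤ θ (2L)³ = M³/2` for `θ = 1/(1024 ρ³)`. Only the `7/10`-separation of the set is
used (finiteness of the bad set in a ball).
-/

noncomputable section

namespace Summit.AtomisticToContinuum.Crystallization.Theorems.PeriodicWindowsSketch

open Literature.MathematicalPhysics.StatisticalMechanics Filter Metric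

/-- Coordinates are `1`-Lipschitz: `|p l - q l| ≤ dist p q` in `ℝ³`. -/
private theorem coord_sub_le_dist' (p q : EuclideanSpace ℝ (Fin 3)) (l : Fin 3) :
    |p l - q l| ≤ dist p q := by
  rw [← Real.dist_eq]
  exact PiLp.dist_apply_le p q l

/-- A point of `ℝ³` all of whose coordinates are bounded by `b ≥ 0` in absolute value has norm
`≤ 2 b` (crude: `√3 ≤ 2`). -/
private theorem norm_toLp_le (f : Fin 3 → ℝ) {b : ℝ} (hb : 0 ≤ b) (hf : ∀ l, |f l| ≤ b) :
    ‖(WithLp.toLp 2 f : EuclideanSpace ℝ (Fin 3))‖ ≤ 2 * b := by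
  have hsq : ‖(WithLp.toLp 2 f : EuclideanSpace ℝ (Fin 3))‖ ^ 2 ≤ (2 * b) ^ 2 := by
    rw [PiLp.norm_sq_eq_of_L2]
    simp only [Real.norm_eq_abs, sq_abs, Fin.sum_univ_three]
    have h0 := hf 0
    have h1 := hf 1
    have h2 := hf 2
    rw [abs_le] at h0 h1 h2
    nlinarith
  exact (pow_le_pow_iff_left₀ (norm_nonneg _) (by positivity) two_ne_zero).1 hsq

/-- **G2a (proved): pigeonhole — zero density of mirror-bad particles gives clean balls of every
size.** If, in a `7/10`-separated `X`, for every `η > 0`, `r` and `θ > 0` the number of particles in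
`B̄(C, L)` whose `r`-neighbourhood is not two-way `η`-matched with the mirror image of `X` through
their own horizontal plane is `≤ θ L³` for all large `L` and all centres `C`, then for every `ρ` some
ball of radius `ρ` contains no such particle (a cubic grid of `M³` disjoint `ρ`-balls in `B̄(0, 2L)`,
`L = 4ρM`, each holding a bad particle would give `M³ ≤ θ (2L)³ = M³/2`). -/
theorem cleanBalls_of_badDensityZero (X : Set (EuclideanSpace ℝ (Fin 3)))
    (hsep : ∀ p ∈ X, ∀ q ∈ X, p ≠ q → (7 : ℝ) / 10 ≤ dist p q)
    (hbad : ∀ η r θ : ℝ, 0 < η → 0 < θ → ∃ L₀ : ℝ, ∀ L : ℝ, L₀ ≤ L →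
      ∀ C : EuclideanSpace ℝ (Fin 3),
        (({p : EuclideanSpace ℝ (Fin 3) | p ∈ X ∧ dist p C ≤ L ∧ ¬ BallMatch η r p X
          ((fun q => q - (2 * (q 2 - p 2)) • EuclideanSpace.single (2 : Fin 3) (1 : ℝ)) '' X)} :
            Set (EuclideanSpace ℝ (Fin 3))).ncard : ℝ) ≤ θ * L ^ 3) :
    ∀ r η ρ : ℝ, 0 < η → ∃ c : EuclideanSpace ℝ (Fin 3), ∀ p ∈ X, dist p c ≤ ρ →
      BallMatch η r p X
        ((fun q => q - (2 * (q 2 - p 2)) • EuclideanSpace.single (2 : Fin 3) (1 : ℝ)) '' X) := by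
  classical
  intro r η ρ hη
  -- enlarge `ρ` to `ρ' = max ρ 1 > 0`
  set ρ' : ℝ := max ρ 1 with hρ'def
  have hρ'1 : 1 ≤ ρ' := le_max_right _ _
  have hρ'0 : 0 < ρ' := by linarith
  have hρρ' : ρ ≤ ρ' := le_max_left _ _
  -- the density `θ = 1/(1024 ρ'³)` and the scale
  set θ : ℝ := 1 / (1024 * ρ' ^ 3) with hθdef
  have hθ : 0 < θ := by positivity
  obtain ⟨L₀, hL₀⟩ := hbad η r θ hη hθ
  obtain ⟨M, hM1, hML⟩ : ∃ M : ℕ, 1 ≤ M ∧ L₀ ≤ 2 * (4 * ρ' * M) := by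
    refine ⟨max 1 ⌈L₀ / (8 * ρ')⌉₊, le_max_left _ _, ?_⟩
    have h1 : L₀ / (8 * ρ') ≤ ⌈L₀ / (8 * ρ')⌉₊ := Nat.le_ceil _
    have h2 : (⌈L₀ / (8 * ρ')⌉₊ : ℝ) ≤ ((max 1 ⌈L₀ / (8 * ρ')⌉₊ : ℕ) : ℝ) := by
      exact_mod_cast le_max_right _ _
    rw [div_le_iff₀ (by positivity)] at h1
    nlinarith
  set L : ℝ := 4 * ρ' * M with hLdef
  have hM1' : (1 : ℝ) ≤ M := by exact_mod_cast hM1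
  have hLρ : 4 * ρ' ≤ L := by rw [hLdef]; nlinarith
  have hL0 : 0 < L := by linarith
  have hcount := hL₀ (2 * L) hML 0
  -- suppose every `ρ`-ball contains a bad particle
  by_contra hno
  push Not at hno
  choose f hfX hfd hfbad using hno
  -- the cubic grid of `M³` centres, spacing `4ρ'`, inside the cube of side `L` about `0`
  set a : Fin M → ℝ := fun m => 4 * ρ' * m + 2 * ρ' - L / 2 with hadef
  have ha_abs : ∀ m : Fin M, |a m| ≤ L / 2 := by
    intro m
    have hm0 : (0 : ℝ) ≤ (m : ℕ) := Nat.cast_nonneg _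
    have hm1 : ((m : ℕ) : ℝ) + 1 ≤ M := by exact_mod_cast m.2
    rw [abs_le, hadef]
    dsimp only
    constructor <;> nlinarith
  have ha_sep : ∀ m m' : Fin M, m ≠ m' → 4 * ρ' ≤ |a m - a m'| := by
    intro m m' hne
    have hsub : a m - a m' = 4 * ρ' * ((m : ℕ) - (m' : ℕ) : ℝ) := by rw [hadef]; dsimp only; ring
    rw [hsub, abs_mul, abs_of_pos (by positivity : (0 : ℝ) < 4 * ρ')]
    have hz : (1 : ℝ) ≤ |((m : ℕ) : ℝ) - ((m' : ℕ) : ℝ)| := by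
      have hne' : (m : ℕ) ≠ (m' : ℕ) := fun h => hne (Fin.ext h)
      rcases Nat.lt_or_gt_of_ne hne' with h | h
      · have : ((m : ℕ) : ℝ) + 1 ≤ ((m' : ℕ) : ℝ) := by exact_mod_cast h
        rw [abs_of_neg (by linarith)]
        linarith
      · have : ((m' : ℕ) : ℝ) + 1 ≤ ((m : ℕ) : ℝ) := by exact_mod_cast h
        rw [abs_of_pos (by linarith)]
        linarith
    nlinarith
  set g : (Fin 3 → Fin M) → EuclideanSpace ℝ (Fin 3) :=
    fun i => WithLp.toLp 2 (fun l => a (i l)) with hgdef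
  have hg_apply : ∀ i l, g i l = a (i l) := fun i l => rfl
  have hg_norm : ∀ i, ‖g i‖ ≤ L := fun i =>
    (norm_toLp_le _ (by positivity) fun l => ha_abs (i l)).trans (by linarith)
  -- the bad particles attached to the grid
  set F : (Fin 3 → Fin M) → EuclideanSpace ℝ (Fin 3) := fun i => f (g i) with hFdef
  have hFinj : Function.Injective F := by
    intro i i' hii'
    by_contra hne
    obtain ⟨l, hl⟩ : ∃ l, i l ≠ i' l := by
      by_contra hall
      push Not at hall
      exact hne (funext hall)
    have h1 : dist (g i) (g i') ≤ 2 * ρ' :=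
      calc dist (g i) (g i') ≤ dist (f (g i)) (g i) + dist (f (g i)) (g i') :=
            dist_triangle_left _ _ _
        _ = dist (f (g i)) (g i) + dist (f (g i')) (g i') := by
            show dist (F i) (g i) + dist (F i) (g i') = dist (F i) (g i) + dist (F i') (g i')
            rw [hii']
        _ ≤ ρ + ρ := add_le_add (hfd _) (hfd _)
        _ ≤ 2 * ρ' := by linarith
    have h2 : 4 * ρ' ≤ dist (g i) (g i') :=
      calc 4 * ρ' ≤ |a (i l) - a (i' l)| := ha_sep _ _ hl
        _ = |g i l - g i' l| := by rw [hg_apply, hg_apply]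
        _ ≤ dist (g i) (g i') := coord_sub_le_dist' _ _ _
    linarith
  -- its image lies in the bad set of `B̄(0, 2L)`
  set S : Set (EuclideanSpace ℝ (Fin 3)) := {p | p ∈ X ∧ dist p 0 ≤ 2 * L ∧ ¬ BallMatch η r p X
    ((fun q => q - (2 * (q 2 - p 2)) • EuclideanSpace.single (2 : Fin 3) (1 : ℝ)) '' X)} with hSdef
  have hSfin : S.Finite := by
    refine finite_of_forall_le_dist_of_subset_closedBall (by norm_num : (0 : ℝ) < 7 / 10)
      (fun p hp q hq hpq => hsep p hp.1 q hq.1 hpq) (c := 0) (R := 2 * L) ?_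
    intro p hp
    exact mem_closedBall.2 hp.2.1
  have himg : ↑(Finset.univ.image F) ⊆ S := by
    intro p hp
    rw [Finset.coe_image, Finset.coe_univ, Set.image_univ] at hp
    obtain ⟨i, rfl⟩ := hp
    refine ⟨hfX _, ?_, hfbad _⟩
    calc dist (f (g i)) 0 ≤ dist (f (g i)) (g i) + dist (g i) 0 := dist_triangle _ _ _
      _ ≤ ρ + L := add_le_add (hfd _) (by rw [dist_zero_right]; exact hg_norm i)
      _ ≤ 2 * L := by linarith
  have hcard : ((M : ℝ) ^ 3) ≤ (S.ncard : ℝ) := by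
    have h1 : (Finset.univ.image F).card = M ^ 3 := by
      rw [Finset.card_image_of_injective _ hFinj, Finset.card_univ, Fintype.card_fun,
        Fintype.card_fin, Fintype.card_fin]
    have h2 : (Finset.univ.image F).card ≤ S.ncard := by
      rw [← Set.ncard_coe_finset]
      exact Set.ncard_le_ncard himg hSfin
    rw [h1] at h2
    exact_mod_cast h2
  -- contradiction: `M³ ≤ θ (2L)³ = M³ / 2`
  have hθL : θ * (2 * L) ^ 3 = (M : ℝ) ^ 3 / 2 := by
    rw [hθdef, hLdef]
    field_simp
    ring
  have hM3 : (1 : ℝ) ≤ (M : ℝ) ^ 3 := one_le_pow₀ hM1'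
  have := hcard.trans hcount
  rw [hθL] at this
  linarith

end Summit.AtomisticToContinuum.Crystallization.Theorems.PeriodicWindowsSketch

end
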